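import Summits.Ventures.HodgeRepro.Tier4.Common.UnitaryHyperbolicCayley
import Summits.Ventures.HodgeRepro.Tier4.Common.SL2BallTransport

/-!
# Tier4/Common/UnitaryHyperbolicGrowth — the ball growth of `U(J)`, `J` of signature `(1, 1)`: every Haar measure gives
the `log⁺ ℓ¹` sublevel sets measure `≤ C e^((2+ε) T)`

Blind re-derivation cell `pub-hodge-repro`, Tier 4 (README §9–§10), seat t4-typer-2 (gen 5).  Target tree path
`lean/Summits/Ventures/HodgeRepro/Tier4/Common/UnitaryHyperbolicGrowth.lean`; imports Mathlib +
`Common.UnitaryHyperbolicCayley` + `Common.SL2BallTransport`.  STAGE C1 of C-COMMON-SL2BALL (offer S15543, taken S15558),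
module 3/3 — the `ψ`-binders of stage B are discharged for `ψ = cayley hα hβ`:
* `l1C` is submultiplicative (`l1C_mul_le`), `l1C (z • M) = ‖z‖ l1C M`, `l1C (toC M) = ∑ |M i j|`;
* the NORM COMPARISON **`cayConst_mul_l1_le : cayConst α β * l1 h ≤ l1C (cayMat (z, h))`** with
  `cayConst α β = (l1C (C₀⁻¹ D⁻¹) · l1C (D C₀))⁻¹ > 0` (`toC h = C₀⁻¹ D⁻¹ (z⁻¹ • cayMat (z, h)) D C₀`);
* PROPERNESS: compact sets have compact preimages (`isCompact_preimage_cayley`: closed, and inside `univ ×ˢ ball (B / c)`),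
  hence **`tendsto_cocompact_cayley`**;
* **`haar_logSublevel_le_exp_UJ (hα : 0 < α) (hβ : β < 0) [MeasurableSpace ↥(UJ α β)] [BorelSpace ↥(UJ α β)]
  (μ : Measure ↥(UJ α β)) [IsHaarMeasure μ] (hε : 0 < ε) : ∃ C, 0 ≤ C ∧ ∀ T, 0 ≤ T →
  μ {x | log (max 1 (l1C x)) ≤ T} ≤ ofReal (C * exp ((2 + ε) * T))`** = `haar_logSublevel_le_exp_of_hom` at
  `K = Circle` (with `Measure.haar`), `H = ↥(UJ α β)`, `N = l1C`, `c = cayConst α β`.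
* the DEFINITE case (`α > 0`, `β > 0`): **`compactSpace_UJ_of_pos : CompactSpace ↥(UJ α β)`** — the entries of
  `m ∈ U(J)` satisfy `α ‖m i 0‖² + β ‖m i 1‖² = J i i` (`sum_sq_entries_of_mem_UJ`), so `m` and `m⁻¹` lie in a box; the
  closed embedding `g ↦ (g, g⁻¹)` has compact range.
CONSUMER (stage C2, L4-p2 g5 S15566): the `w₀`-slice `atPlace W w₀ ≅ U(Jdiag …)` through `locMat` and
`archSizeAt w₀ ≍ l1C ∘ locMat` give L1-p2's `hslice` of `archBallGrowth_of_slice` with `α = 2 + ε < 3`; at a DEFINITE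
place the same iso with `compactSpace_UJ_of_pos` gives `hcpt` (C-L4-DEF-COMPACT, L1-p1 g4, lead S15587).

Nothing here says anything about the status of the Hodge conjecture for CM abelian varieties, which is NOT proved
(HC_CM is NOT proved by anyone in this repository).
-/

set_option autoImplicit false

noncomputable section

open MeasureTheory Measure Matrix Topology
open scoped MatrixGroups ComplexConjugate

namespace Summit.Ventures.HodgeRepro.Tier4.Common

namespace SL2Ball

/-! ## 6. The norm comparison and properness -/

section Norms

/-- `l1C` is submultiplicative. -/
theorem l1C_mul_le (A B : Matrix (Fin 2) (Fin 2) ℂ) : l1C (A * B) ≤ l1C A * l1C B := by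
  simp only [l1C, Fin.sum_univ_two, Matrix.mul_apply]
  have h := fun i j => norm_add_le (A i 0 * B 0 j) (A i 1 * B 1 j)
  simp only [norm_mul] at h
  have a00 := norm_nonneg (A 0 0); have a01 := norm_nonneg (A 0 1)
  have a10 := norm_nonneg (A 1 0); have a11 := norm_nonneg (A 1 1)
  have b00 := norm_nonneg (B 0 0); have b01 := norm_nonneg (B 0 1)
  have b10 := norm_nonneg (B 1 0); have b11 := norm_nonneg (B 1 1)
  nlinarith [h 0 0, h 0 1, h 1 0, h 1 1, mul_nonneg a00 b10, mul_nonneg a00 b11, mul_nonneg a10 b10,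
    mul_nonneg a10 b11, mul_nonneg a01 b00, mul_nonneg a01 b01, mul_nonneg a11 b00, mul_nonneg a11 b01]

/-- `l1C (z • M) = ‖z‖ * l1C M`. -/
theorem l1C_smul (z : ℂ) (M : Matrix (Fin 2) (Fin 2) ℂ) : l1C (z • M) = ‖z‖ * l1C M := by
  simp only [l1C, Matrix.smul_apply, smul_eq_mul, norm_mul, Finset.mul_sum]

/-- `l1C (toC M) = ∑ i j, |M i j|`. -/
theorem l1C_toC (M : Matrix (Fin 2) (Fin 2) ℝ) : l1C (toC M) = ∑ i : Fin 2, ∑ j : Fin 2, |M i j| := by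
  simp only [l1C, toC_apply, Complex.norm_real, Real.norm_eq_abs]

/-- An entry is bounded by `l1C`. -/
theorem norm_apply_le_l1C (M : Matrix (Fin 2) (Fin 2) ℂ) (i j : Fin 2) : ‖M i j‖ ≤ l1C M := by
  unfold l1C
  calc ‖M i j‖ ≤ ∑ j : Fin 2, ‖M i j‖ := Finset.single_le_sum (fun j _ => norm_nonneg (M i j)) (Finset.mem_univ j)
    _ ≤ ∑ i : Fin 2, ∑ j : Fin 2, ‖M i j‖ :=
        Finset.single_le_sum (fun i _ => Finset.sum_nonneg fun j _ => norm_nonneg (M i j)) (Finset.mem_univ i)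

variable {α β : ℝ}

/-- `l1C (C₀⁻¹ D⁻¹) > 0`. -/
theorem l1C_C₀inv_mul_Dinv_pos (hα : 0 < α) : 0 < l1C (C₀inv * Dinv α β) := by
  refine lt_of_lt_of_le ?_ (norm_apply_le_l1C (C₀inv * Dinv α β) 0 0)
  have h1 : Real.sqrt α ≠ 0 := (Real.sqrt_pos.2 hα).ne'
  simp [C₀inv, Dinv, Matrix.mul_apply, Fin.sum_univ_two, h1]

/-- `l1C (D C₀) > 0`. -/
theorem l1C_Dmat_mul_C₀_pos (hα : 0 < α) : 0 < l1C (Dmat α β * C₀) := by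
  refine lt_of_lt_of_le ?_ (norm_apply_le_l1C (Dmat α β * C₀) 0 0)
  have h1 : Real.sqrt α ≠ 0 := (Real.sqrt_pos.2 hα).ne'
  simp [C₀, Dmat, Matrix.mul_apply, Fin.sum_univ_two, h1]

variable (α β)

/-- The comparison constant `c_J = (l1C (C₀⁻¹ D⁻¹) · l1C (D C₀))⁻¹`. -/
def cayConst : ℝ := (l1C (C₀inv * Dinv α β) * l1C (Dmat α β * C₀))⁻¹

variable {α β}

/-- `c_J > 0`. -/
theorem cayConst_pos (hα : 0 < α) : 0 < cayConst α β :=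
  inv_pos.2 (mul_pos (l1C_C₀inv_mul_Dinv_pos hα) (l1C_Dmat_mul_C₀_pos hα))

/-- `toC h` is recovered from `cayMat (z, h)`: `toC h = C₀⁻¹ D⁻¹ (z⁻¹ • cayMat (z, h)) D C₀`. -/
theorem toC_eq_of_cayMat (hα : 0 < α) (hβ : β < 0) (x : Circle × SL(2, ℝ)) :
    toC (x.2 : Matrix (Fin 2) (Fin 2) ℝ) =
      (C₀inv * Dinv α β) * (((x.1 : ℂ)⁻¹) • cayMat α β x) * (Dmat α β * C₀) := by
  have hz : (x.1 : ℂ)⁻¹ * (x.1 : ℂ) = 1 := inv_mul_cancel₀ (Circle.coe_ne_zero x.1)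
  simp only [cayMat, smul_smul, hz, one_smul, cay₀]
  calc toC (x.2 : Matrix (Fin 2) (Fin 2) ℝ)
      = (C₀inv * C₀) * toC (x.2 : Matrix (Fin 2) (Fin 2) ℝ) * (C₀inv * C₀) := by
        rw [C₀inv_mul_C₀, Matrix.one_mul, Matrix.mul_one]
    _ = C₀inv * (Dinv α β * Dmat α β) * (C₀ * toC (x.2 : Matrix (Fin 2) (Fin 2) ℝ) * C₀inv) *
          (Dinv α β * Dmat α β) * C₀ := by
        rw [Dinv_mul_Dmat hα hβ]
        simp only [Matrix.mul_one, Matrix.mul_assoc]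
    _ = _ := by simp only [Matrix.mul_assoc]

/-- **The norm comparison**: `c_J · l1 h ≤ l1C (cayMat (z, h))`. -/
theorem cayConst_mul_l1_le (hα : 0 < α) (hβ : β < 0) (x : Circle × SL(2, ℝ)) :
    cayConst α β * l1 x.2 ≤ l1C (cayMat α β x) := by
  have hK : 0 < l1C (C₀inv * Dinv α β) * l1C (Dmat α β * C₀) :=
    mul_pos (l1C_C₀inv_mul_Dinv_pos hα) (l1C_Dmat_mul_C₀_pos hα)
  have h1 : l1 x.2 ≤ (l1C (C₀inv * Dinv α β) * l1C (Dmat α β * C₀)) * l1C (cayMat α β x) := by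
    have hz : ‖(x.1 : ℂ)⁻¹‖ = 1 := by rw [norm_inv, Circle.norm_coe, inv_one]
    calc l1 x.2 = l1C (toC (x.2 : Matrix (Fin 2) (Fin 2) ℝ)) := (l1C_toC _).symm
      _ = l1C ((C₀inv * Dinv α β) * (((x.1 : ℂ)⁻¹) • cayMat α β x) * (Dmat α β * C₀)) := by
          rw [toC_eq_of_cayMat hα hβ]
      _ ≤ l1C ((C₀inv * Dinv α β) * (((x.1 : ℂ)⁻¹) • cayMat α β x)) * l1C (Dmat α β * C₀) := l1C_mul_le _ _
      _ ≤ (l1C (C₀inv * Dinv α β) * l1C (((x.1 : ℂ)⁻¹) • cayMat α β x)) * l1C (Dmat α β * C₀) :=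
          mul_le_mul_of_nonneg_right (l1C_mul_le _ _) (l1C_nonneg _)
      _ = (l1C (C₀inv * Dinv α β) * l1C (Dmat α β * C₀)) * l1C (cayMat α β x) := by
          rw [l1C_smul, hz, one_mul]
          ring
  rw [cayConst, ← div_eq_inv_mul, div_le_iff₀ hK]
  linarith

/-- Compact sets have compact `cayley`-preimages. -/
theorem isCompact_preimage_cayley (hα : 0 < α) (hβ : β < 0) {K : Set ↥(UJ α β)} (hK : IsCompact K) :
    IsCompact (cayley hα hβ ⁻¹' K) := by
  haveI := t2Space_UJ α β
  have hN : Continuous fun x : ↥(UJ α β) => l1C ((x : GL (Fin 2) ℂ) : Matrix (Fin 2) (Fin 2) ℂ) :=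
    continuous_l1C.comp (Units.continuous_val.comp continuous_subtype_val)
  obtain ⟨B, hB⟩ := hK.exists_bound_of_continuousOn hN.continuousOn
  have hc := cayConst_pos (β := β) hα
  have hsub : cayley hα hβ ⁻¹' K ⊆ (Set.univ : Set Circle) ×ˢ ball (B / cayConst α β) := by
    intro x hx
    refine ⟨Set.mem_univ _, ?_⟩
    show l1 x.2 ≤ B / cayConst α β
    rw [le_div_iff₀ hc, mul_comm]
    calc cayConst α β * l1 x.2 ≤ l1C (cayMat α β x) := cayConst_mul_l1_le hα hβ x
      _ ≤ B := by
          have := hB _ hx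
          rw [coe_cayley, Real.norm_eq_abs] at this
          exact (le_abs_self _).trans this
  exact (isCompact_univ.prod (isCompact_ball _)).of_isClosed_subset
    (hK.isClosed.preimage (continuous_cayley hα hβ)) hsub

/-- `cayley` is proper: `Tendsto cayley (cocompact _) (cocompact _)`. -/
theorem tendsto_cocompact_cayley (hα : 0 < α) (hβ : β < 0) :
    Filter.Tendsto (cayley hα hβ) (Filter.cocompact (Circle × SL(2, ℝ))) (Filter.cocompact ↥(UJ α β)) := by
  refine Filter.hasBasis_cocompact.tendsto_right_iff.2 fun K hK => ?_
  exact Filter.mem_cocompact.2 ⟨cayley hα hβ ⁻¹' K, isCompact_preimage_cayley hα hβ hK, fun x hx => hx⟩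

end Norms

/-! ## 7. The ball growth of `U(J)` -/

section Growth

variable {α β : ℝ}

/-- **Haar measure of the `ℓ¹` sublevel sets of `U(J)` grows at most like `e^((2+ε) T)`** (stage C1 + stage B): for
`J = diag (α, β)` with `α > 0 > β`, every Haar measure `μ` on `↥(UJ α β)` and every `ε > 0`, there is `C ≥ 0` with
`μ {x | log (max 1 (l1C x)) ≤ T} ≤ C e^((2+ε) T)` for all `T ≥ 0` — `haar_logSublevel_le_exp_of_hom` along the Cayley
homomorphism `cayley : Circle × SL(2, ℝ) →* U(J)` (continuous, surjective, proper) with the comparison `c_J · l1 h ≤ l1C`. -/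
theorem haar_logSublevel_le_exp_UJ (hα : 0 < α) (hβ : β < 0)
    [MeasurableSpace ↥(UJ α β)] [BorelSpace ↥(UJ α β)] (μ : Measure ↥(UJ α β)) [IsHaarMeasure μ]
    {ε : ℝ} (hε : 0 < ε) :
    ∃ C : ℝ, 0 ≤ C ∧ ∀ T : ℝ, 0 ≤ T →
      μ {x | Real.log (max 1 (l1C ((x : GL (Fin 2) ℂ) : Matrix (Fin 2) (Fin 2) ℂ))) ≤ T} ≤
        ENNReal.ofReal (C * Real.exp ((2 + ε) * T)) := by
  haveI := locallyCompactSpace_UJ α β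
  haveI := secondCountableTopology_UJ α β
  letI : MeasurableSpace SL(2, ℝ) := borel _
  haveI : BorelSpace SL(2, ℝ) := ⟨rfl⟩
  letI : MeasurableSpace Circle := borel _
  haveI : BorelSpace Circle := ⟨rfl⟩
  exact haar_logSublevel_le_exp_of_hom (MeasureTheory.Measure.haar (G := Circle)) (cayley hα hβ)
    (continuous_cayley hα hβ) (cayley_surjective hα hβ) (tendsto_cocompact_cayley hα hβ)
    (fun x : ↥(UJ α β) => l1C ((x : GL (Fin 2) ℂ) : Matrix (Fin 2) (Fin 2) ℂ))
    (continuous_l1C.comp (Units.continuous_val.comp continuous_subtype_val))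
    (cayConst_pos (β := β) hα) (fun k h => cayConst_mul_l1_le hα hβ (k, h)) μ hε

end Growth

/-! ## 8. The definite case: `U(J)` is compact when `α > 0` and `β > 0` -/

section Definite

variable {α β : ℝ}

/-- The diagonal identity `α ‖m i 0‖² + β ‖m i 1‖² = J i i` for `m ∈ U(J)`. -/
theorem sum_sq_entries_of_mem_UJ {m : GL (Fin 2) ℂ} (hm : m ∈ UJ α β) (i : Fin 2) :
    α * ‖(m : Matrix (Fin 2) (Fin 2) ℂ) i 0‖ ^ 2 + β * ‖(m : Matrix (Fin 2) (Fin 2) ℂ) i 1‖ ^ 2 =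
      (![α, β] : Fin 2 → ℝ) i := by
  have h := congrFun (congrFun (mem_UJ.1 hm) i) i
  have hre := congrArg Complex.re h
  simp only [Matrix.mul_apply, Fin.sum_univ_two, Matrix.conjTranspose_apply, Jmat, Matrix.diagonal_apply_eq,
    Complex.add_re, Complex.mul_re, Complex.conj_re, Complex.conj_im, Complex.star_def] at hre
  have e0 : ‖(m : Matrix (Fin 2) (Fin 2) ℂ) i 0‖ ^ 2 = ((m : Matrix (Fin 2) (Fin 2) ℂ) i 0).re ^ 2 +
      ((m : Matrix (Fin 2) (Fin 2) ℂ) i 0).im ^ 2 := by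
    rw [← Complex.normSq_eq_norm_sq, Complex.normSq_apply]; ring
  have e1 : ‖(m : Matrix (Fin 2) (Fin 2) ℂ) i 1‖ ^ 2 = ((m : Matrix (Fin 2) (Fin 2) ℂ) i 1).re ^ 2 +
      ((m : Matrix (Fin 2) (Fin 2) ℂ) i 1).im ^ 2 := by
    rw [← Complex.normSq_eq_norm_sq, Complex.normSq_apply]; ring
  rw [e0, e1]
  fin_cases i <;> simp at hre ⊢ <;> nlinarith [hre]

/-- In the definite case every entry of `m ∈ U(J)` is bounded by `√(max α β / min α β)`. -/
theorem norm_entry_le_of_mem_UJ (hα : 0 < α) (hβ : 0 < β) {m : GL (Fin 2) ℂ} (hm : m ∈ UJ α β) (i j : Fin 2) :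
    ‖(m : Matrix (Fin 2) (Fin 2) ℂ) i j‖ ≤ Real.sqrt (max α β / min α β) := by
  have hmin : 0 < min α β := lt_min hα hβ
  have h := sum_sq_entries_of_mem_UJ hm i
  have hJ : (![α, β] : Fin 2 → ℝ) i ≤ max α β := by fin_cases i <;> simp
  have h0 := sq_nonneg ‖(m : Matrix (Fin 2) (Fin 2) ℂ) i 0‖
  have h1 := sq_nonneg ‖(m : Matrix (Fin 2) (Fin 2) ℂ) i 1‖
  have hsq : ‖(m : Matrix (Fin 2) (Fin 2) ℂ) i j‖ ^ 2 ≤ max α β / min α β := by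
    rw [le_div_iff₀ hmin]
    have hαm : min α β ≤ α := min_le_left _ _
    have hβm : min α β ≤ β := min_le_right _ _
    fin_cases j
    · simp only [Fin.zero_eta, Fin.isValue]
      nlinarith [mul_le_mul_of_nonneg_right hαm h0, mul_nonneg hβ.le h1]
    · simp only [Fin.mk_one, Fin.isValue]
      nlinarith [mul_le_mul_of_nonneg_right hβm h1, mul_nonneg hα.le h0]
  exact Real.le_sqrt_of_sq_le hsq

/-- **The definite case: `U(J)` is compact for `α > 0`, `β > 0`** — closed in `GL(2, ℂ)` with uniformly bounded entries
of `m` and `m⁻¹`, through the closed embedding `g ↦ (g, g⁻¹)` into `M₂(ℂ) × M₂(ℂ)ᵐᵒᵖ`. -/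
theorem compactSpace_UJ_of_pos (hα : 0 < α) (hβ : 0 < β) : CompactSpace ↥(UJ α β) := by
  set R : ℝ := Real.sqrt (max α β / min α β) with hR
  set K : Set (Matrix (Fin 2) (Fin 2) ℂ) :=
    (Set.pi Set.univ fun _ : Fin 2 => Set.pi Set.univ fun _ : Fin 2 => Metric.closedBall (0 : ℂ) R :
      Set (Fin 2 → Fin 2 → ℂ)) with hK
  have hKc : IsCompact K := by
    rw [hK]
    exact isCompact_univ_pi fun _ => isCompact_univ_pi fun _ => isCompact_closedBall _ _
  have hmemK : ∀ {m : GL (Fin 2) ℂ}, m ∈ UJ α β → (m : Matrix (Fin 2) (Fin 2) ℂ) ∈ K := by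
    intro m hm
    show ∀ i ∈ (Set.univ : Set (Fin 2)), (m : Matrix (Fin 2) (Fin 2) ℂ) i ∈
      Set.pi Set.univ fun _ : Fin 2 => Metric.closedBall (0 : ℂ) R
    intro i _
    show ∀ j ∈ (Set.univ : Set (Fin 2)), (m : Matrix (Fin 2) (Fin 2) ℂ) i j ∈ Metric.closedBall (0 : ℂ) R
    intro j _
    rw [Metric.mem_closedBall, dist_zero_right]
    exact norm_entry_le_of_mem_UJ hα hβ hm i j
  have hKK : IsCompact (K ×ˢ (MulOpposite.op '' K)) :=
    hKc.prod (hKc.image MulOpposite.continuous_op)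
  have hpre : (fun g : ↥(UJ α β) => Units.embedProduct (Matrix (Fin 2) (Fin 2) ℂ) (g : GL (Fin 2) ℂ)) ⁻¹'
      (K ×ˢ (MulOpposite.op '' K)) = Set.univ := by
    refine Set.eq_univ_of_forall fun g => ?_
    rw [Set.mem_preimage, Units.embedProduct_apply]
    exact ⟨hmemK g.2, ⟨_, hmemK ((UJ α β).inv_mem g.2), rfl⟩⟩
  refine ⟨?_⟩
  rw [← hpre]
  exact (isClosedEmbedding_UJ_embed α β).isCompact_preimage hKK

/-- `U(-J) = U(J)`. -/
theorem UJ_neg_neg (α β : ℝ) : UJ (-α) (-β) = UJ α β := by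
  have hJ : Jmat (-α) (-β) = -Jmat α β := by
    ext i j
    fin_cases i <;> fin_cases j <;> simp [Jmat]
  ext m
  simp only [mem_UJ, hJ, Matrix.mul_neg, Matrix.neg_mul, neg_inj]

/-- **The negative-definite case**: `U(J)` is compact for `α < 0`, `β < 0`. -/
theorem compactSpace_UJ_of_neg (hα : α < 0) (hβ : β < 0) : CompactSpace ↥(UJ α β) := by
  rw [← UJ_neg_neg α β]
  exact compactSpace_UJ_of_pos (by linarith) (by linarith)

end Definite

end SL2Ball

end Summit.Ventures.HodgeRepro.Tier4.Common
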